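import Summits.NavierStokesRegularity.NavierStokesRegularity.Theorems.LerayQuarterDissipationFiniteDissipationLiouvilleSubthreshold
import HarnessLib

/-!
# Crux `FiniteDissipationLiouville` (stmt-NavierStokesRegularity-22144): compactness of the stratum
# across DIFFERENT members, and persistence of the apex singularity along any convergent sequence

Theorems file of route `LerayQuarterDissipation` (seat ns-lqd-p1 g2; `--supports` the crux; tools
for the critical-element file). Navier–Stokes regularity is NOT proved by anything here; no summit
is. `𝒟_{C,K}` = Type-I ancient mild fields in the KNSS gauge with constant `C` and the quarter-rate
dissipation law with constant `K`.

* `seqLimit` — **KNSS compactness across members**: every sequence `w k` of Type-I ancient mild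
  fields with a common constant `C` has a subsequence converging — uniformly on every slab piece
  `[−(n+2), −1/(n+2)] × B̄(0, n+2)`, pointwise on the open slab, together with the spatial
  gradients pointwise — to a field of the same class (the two-step extraction of p1 g0's
  `RecurrentReductionD.orbitLimit`, which is the special case `w k = u_{l_k}`; tree theorems
  `exists_tendstoUniformlyOn_triple_of_typeI_oseenMild_windows`, `exists_tendsto_of_typeI_oseenMild_windows`).
* `law_of_seqLimit` — if `w k ∈ 𝒟_{C,K_k}` with `K_k ≤ K_∞ + ε` for all large `k` (every `ε > 0`),
  the limit has the law with constant `K_∞` (Fatou with eventual bounds).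
* `persistent_singularity_seq` — **persistence of the apex singularity across members**: if
  `w k ∈ 𝒟_{C,K}` are all singular at the apex and converge uniformly on the slab pieces to a
  Type-I ancient mild field `W`, then `W` is singular at the apex. This is p1 g0's
  `RecurrentReductionD.persistent_singularity` (there: `w k = u_{l_k}`, rescalings of ONE singular
  member) with the same proof — zoom by a small factor `μ`, uniform smallness of one slice of one
  `w k` on a ball, the class's sup-norm ε-regularity (`RecurrentReductionD.epsilon_regularity`),
  scale invariance of the singularity — run for an arbitrary sequence: only the membership of each
  `w k` in `𝒟_{C,K}` and its own singularity are used.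
  Consequence: the set of singular members of `𝒟_{C,K}` is CLOSED under this convergence.

References: Koch–Nadirashvili–Seregin–Šverák, Acta Math. 203 (2009) = arXiv:0709.3599, §4, Lemma 6.1;
Albritton–Barker, arXiv:1811.00502, Prop. 2.3; Rusin–Šverák, arXiv:0911.0500, Lemma 2.1–2.2.
-/

noncomputable section

-- the summit and its single sub-problem share the name (CONVENTIONS §1), as in every Theorems file
set_option linter.dupNamespace false

namespace Summit.NavierStokesRegularity.NavierStokesRegularity.Theorems.FiniteDissipationLiouville.Compactness

open MeasureTheory Set Filter Topology Metric Function
open Literature.Analysis Literature.Analysis.FluidPDE Literature.Analysis.UnboundedOperators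
open Summit.NavierStokesRegularity.NavierStokesRegularity.Theorems.AdaptedFrequencyConverges.BirkhoffRecurrentHull
  (tendstoUniformlyOn_comp_of_tendsto)
open scoped ENNReal NNReal

/-! ### Compactness across members -/

/-- **KNSS compactness across members of the Type-I class.** A sequence of Type-I ancient mild
fields with a common constant `C` subconverges — uniformly on the slab pieces, pointwise on the open
slab, with pointwise convergence of the spatial gradients — to a Type-I ancient mild field with
constant `C`. (Adapted from `RecurrentReductionD.orbitLimit`, Theorems/…RecurrentReductionDRecurrent.) -/
theorem seqLimit {C : ℝ} {w : ℕ → ℝ → EuclideanSpace ℝ (Fin 3) → EuclideanSpace ℝ (Fin 3)}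
    (hwk : ∀ k, IsTypeIAncientMild C (w k)) :
    ∃ ψ : ℕ → ℕ, StrictMono ψ ∧
      ∃ W : ℝ → EuclideanSpace ℝ (Fin 3) → EuclideanSpace ℝ (Fin 3),
        IsTypeIAncientMild C W ∧
        (∀ n : ℕ, TendstoUniformlyOn (fun j z => w (ψ j) z.1 z.2) (fun z => W z.1 z.2)
          atTop (Icc (-((n : ℝ) + 2)) (-(1 / ((n : ℝ) + 2))) ×ˢ
            closedBall (0 : EuclideanSpace ℝ (Fin 3)) ((n : ℝ) + 2))) ∧
        (∀ t < 0, ∀ x, Tendsto (fun j => w (ψ j) t x) atTop (𝓝 (W t x))) ∧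
        (∀ t < 0, ∀ x, Tendsto (fun j => fderiv ℝ (w (ψ j) t) x) atTop (𝓝 (fderiv ℝ (W t) x))) := by
  have hC : 0 ≤ C := (hwk 0).nonneg
  -- ## windows `[-(k+1), 0)` and the data on them
  set A : ℕ → ℝ := fun k => -((k : ℝ) + 1) with hA
  have hAt : Tendsto A atTop atBot :=
    tendsto_neg_atTop_atBot.comp (tendsto_atTop_add_const_right _ 1 tendsto_natCast_atTop_atTop)
  have hcw : ∀ k, ContinuousOn (uncurry (w k)) (Ioo (A k) 0 ×ˢ univ) := fun k =>
    (hwk k).continuousOn_uncurry.mono (prod_mono Ioo_subset_Iio_self Subset.rfl)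
  have hdivw : ∀ k, ∀ t ∈ Ioo (A k) 0, IsWeaklyDivFree (w k t) := fun k t ht =>
    (hwk k).isWeaklyDivFree ht.2
  have hmild : ∀ k, ∀ s t : ℝ, A k < s → s < t → t < 0 → ∀ x,
      w k t x = Literature.Analysis.UnboundedOperators.heatExtension (w k s) (t - s) x -
        oseenDuhamel 1 s (w k) (w k) t x :=
    fun k s t _ hst ht x => (hwk k).mild_eq_heatExtension hst ht x
  have hIw : ∀ k, ∀ t ∈ Ioo (A k) 0, ∀ x, ‖w k t x‖ ≤ C / Real.sqrt (-t) := fun k t ht x =>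
    (hwk k).norm_le ht.2 x
  -- ## Step 1: uniform convergence on the slab pieces
  obtain ⟨φ₁, hφ₁, W₁, G₁, H₁, hW₁, -, -⟩ :=
    exists_tendstoUniformlyOn_triple_of_typeI_oseenMild_windows hC hAt hcw hdivw hmild hIw
  have hφ₁t : Tendsto φ₁ atTop atTop := hφ₁.tendsto_atTop
  -- ## Step 2: the class of the limit and the gradients, along a further subsequence
  obtain ⟨φ₂, hφ₂, W, hW, hlu0, hlu1, -⟩ :=
    exists_tendsto_of_typeI_oseenMild_windows hC (hAt.comp hφ₁t) (w := fun j => w (φ₁ j))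
      (fun j => hcw (φ₁ j)) (fun j => hdivw (φ₁ j)) (fun j => hmild (φ₁ j)) (fun j => hIw (φ₁ j))
  have hφ₂t : Tendsto φ₂ atTop atTop := hφ₂.tendsto_atTop
  -- the two limits agree on the open slab
  have hWW : ∀ t < 0, ∀ x, W₁ t x = W t x := by
    intro t ht x
    have h1 : Tendsto (fun j => w (φ₁ (φ₂ j)) t x) atTop (𝓝 (W₁ t x)) :=
      (tendsto_of_tendstoUniformlyOn_slabPiece hW₁ ht x).comp hφ₂t
    have h2 : Tendsto (fun j => w (φ₁ (φ₂ j)) t x) atTop (𝓝 (W t x)) :=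
      tendsto_at_of_tendstoLocallyUniformly (hlu0 t ht) x
    exact tendsto_nhds_unique h1 h2
  have hWu : ∀ n : ℕ, TendstoUniformlyOn (fun j z => w (φ₁ (φ₂ j)) z.1 z.2) (fun z => W z.1 z.2)
      atTop (Icc (-((n : ℝ) + 2)) (-(1 / ((n : ℝ) + 2))) ×ˢ
        closedBall (0 : EuclideanSpace ℝ (Fin 3)) ((n : ℝ) + 2)) := fun n =>
    (tendstoUniformlyOn_comp_of_tendsto (hW₁ n) hφ₂t).congr_right fun z hz =>
      hWW z.1 (neg_of_mem_slabPiece hz) z.2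
  refine ⟨fun j => φ₁ (φ₂ j), hφ₁.comp hφ₂, W, hW, hWu, fun t ht x => ?_, fun t ht x => ?_⟩
  · exact tendsto_at_of_tendstoLocallyUniformly (hlu0 t ht) x
  · exact tendsto_at_of_tendstoLocallyUniformly (hlu1 t ht) x

/-- **The law of the limit.** If `w k ∈ 𝒟_{C,K_k}` with `K_k ≤ K_∞ + ε` for all large `k`, for every
`ε > 0`, and the spatial gradients of `w (ψ k)` converge pointwise to those of `W` (`ψ → ∞`), then
`W` obeys the law with constant `K_∞`. -/
theorem law_of_seqLimit {Kinf : ℝ} {Kk : ℕ → ℝ}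
    {w : ℕ → ℝ → EuclideanSpace ℝ (Fin 3) → EuclideanSpace ℝ (Fin 3)}
    {W : ℝ → EuclideanSpace ℝ (Fin 3) → EuclideanSpace ℝ (Fin 3)} {ψ : ℕ → ℕ}
    (hψ : Tendsto ψ atTop atTop)
    (hlaw : ∀ k, ∀ s : ℝ, s < 0 →
      ∫⁻ x, ‖fderiv ℝ (w k s) x‖ₑ ^ 2 ≤ ENNReal.ofReal (Kk k / Real.sqrt (-s)))
    (hK : ∀ ε : ℝ, 0 < ε → ∀ᶠ k in atTop, Kk k ≤ Kinf + ε)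
    (hgrad : ∀ t < 0, ∀ x, Tendsto (fun j => fderiv ℝ (w (ψ j) t) x) atTop (𝓝 (fderiv ℝ (W t) x))) :
    ∀ s : ℝ, s < 0 → ∫⁻ x, ‖fderiv ℝ (W s) x‖ₑ ^ 2 ≤ ENNReal.ofReal (Kinf / Real.sqrt (-s)) := by
  intro s hs
  have ha : 0 < Real.sqrt (-s) := Real.sqrt_pos.2 (neg_pos.2 hs)
  -- for every `ε > 0`: the bound with `Kinf + ε`
  have hε : ∀ ε : ℝ, 0 < ε →
      ∫⁻ x, ‖fderiv ℝ (W s) x‖ₑ ^ 2 ≤ ENNReal.ofReal ((Kinf + ε) / Real.sqrt (-s)) := by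
    intro ε hε
    refine Subthreshold.lintegral_fderiv_sq_le_of_tendsto_of_eventually (hgrad s hs) ?_
    filter_upwards [hψ.eventually (hK ε hε)] with j hj
    exact (hlaw (ψ j) s hs).trans (ENNReal.ofReal_le_ofReal
      (div_le_div_of_nonneg_right hj ha.le))
  refine ENNReal.le_of_forall_pos_le_add fun δ hδ _ => ?_
  have key := hε (δ * Real.sqrt (-s)) (by positivity)
  refine key.trans ?_
  rw [add_div, mul_div_cancel_right₀ _ ha.ne']
  calc ENNReal.ofReal (Kinf / Real.sqrt (-s) + δ)
      ≤ ENNReal.ofReal (Kinf / Real.sqrt (-s)) + ENNReal.ofReal (δ : ℝ) := ENNReal.ofReal_add_le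
    _ = ENNReal.ofReal (Kinf / Real.sqrt (-s)) + δ := by rw [ENNReal.ofReal_coe_nnreal]

/-! ### Persistence of the apex singularity across members -/

/-- **Persistence of the apex singularity along a convergent sequence of singular members of
`𝒟_{C,K}`.** If `w k` are Type-I ancient mild (constant `C`) with the quarter-rate law (constant
`K`), each singular at the apex, and converge uniformly on every slab piece to a Type-I ancient
mild field `W`, then `W` is singular at the apex. (p1 g0's `persistent_singularity`, verbatim for an
arbitrary sequence.) [cite: KochNadirashviliSereginSverak2009, §4 (arXiv:0709.3599 p. 8)] -/
theorem persistent_singularity_seq {C K : ℝ}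
    {w : ℕ → ℝ → EuclideanSpace ℝ (Fin 3) → EuclideanSpace ℝ (Fin 3)}
    (hwk : ∀ k, IsTypeIAncientMild C (w k))
    (hlaw : ∀ k, ∀ s : ℝ, s < 0 →
      ∫⁻ x, ‖fderiv ℝ (w k s) x‖ₑ ^ 2 ≤ ENNReal.ofReal (K / Real.sqrt (-s)))
    (hsing : ∀ k, ∀ r > 0, ∀ M : ℝ, ∃ t ∈ Ioo (-(r ^ 2)) (0 : ℝ),
      ∃ x ∈ ball (0 : EuclideanSpace ℝ (Fin 3)) r, M < ‖w k t x‖)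
    {W : ℝ → EuclideanSpace ℝ (Fin 3) → EuclideanSpace ℝ (Fin 3)} (hW : IsTypeIAncientMild C W)
    (hunif : ∀ n : ℕ, TendstoUniformlyOn (fun k z => w k z.1 z.2) (fun z => W z.1 z.2)
      atTop (Icc (-((n : ℝ) + 2)) (-(1 / ((n : ℝ) + 2))) ×ˢ
        closedBall (0 : EuclideanSpace ℝ (Fin 3)) ((n : ℝ) + 2))) :
    ∀ r > 0, ∀ M : ℝ, ∃ t ∈ Ioo (-(r ^ 2)) (0 : ℝ),
      ∃ x ∈ ball (0 : EuclideanSpace ℝ (Fin 3)) r, M < ‖W t x‖ := by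
  -- adapted from Theorems/LerayQuarterDissipationRecurrentReductionD.lean (`persistent_singularity`)
  -- the `L⁶` constant of the class and the ε-regularity scales
  obtain ⟨CS, hCS⟩ := RecurrentReductionD.eLpNorm_six_le_of_dissipationLaw
  set k₆ : ℝ := (CS : ℝ) * Real.sqrt (max K 0) with hk₆
  have hk₆0 : 0 ≤ k₆ := by rw [hk₆]; positivity
  obtain ⟨t₁, ht₁, A, hA, ε₀, hε₀, hER⟩ :=
    RecurrentReductionD.epsilon_regularity (k₆ := k₆) hW.nonneg hk₆0
  set s : ℝ := -t₁ with hs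
  have hspos : 0 < s := by rw [hs]; exact neg_pos.2 ht₁
  intro r hr Mb
  by_contra hcon
  push Not at hcon
  -- `W` is bounded by `Mb' > 0` on `(−r², 0) × B(0, r)`
  set Mb' : ℝ := max Mb 1 with hMb'
  have hMb'pos : 0 < Mb' := lt_of_lt_of_le one_pos (le_max_right _ _)
  have hWb : ∀ t ∈ Ioo (-(r ^ 2)) (0 : ℝ), ∀ x ∈ ball (0 : EuclideanSpace ℝ (Fin 3)) r,
      ‖W t x‖ ≤ Mb' := fun t ht x hx => (hcon t ht x hx).trans (le_max_left _ _)
  -- ## the zoom factor `μ`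
  set B : ℝ := Mb' + A + Real.sqrt s + 1 with hB
  have hBpos : 0 < B := by rw [hB]; positivity
  set m : ℝ := min (min ε₀ r) 1 with hm
  have hmpos : 0 < m := by rw [hm]; exact lt_min (lt_min hε₀ hr) one_pos
  have hmε : m ≤ ε₀ := (min_le_left _ _).trans (min_le_left _ _)
  have hmr : m ≤ r := (min_le_left _ _).trans (min_le_right _ _)
  have hm1 : m ≤ 1 := min_le_right _ _
  set μ : ℝ := m / (2 * B) with hμ
  have hμpos : 0 < μ := by rw [hμ]; positivity
  have hBne : B ≠ 0 := hBpos.ne'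
  have hμB : μ * B = m / 2 := by rw [hμ]; field_simp
  have hμMb : μ * Mb' ≤ ε₀ / 2 := by
    have : μ * Mb' ≤ μ * B :=
      mul_le_mul_of_nonneg_left (by rw [hB]; have := Real.sqrt_nonneg s; linarith) hμpos.le
    linarith
  have hμA : μ * A < r ∧ μ * A ≤ 1 / 2 := by
    have : μ * A ≤ μ * B - μ := by
      rw [← mul_sub_one]; refine mul_le_mul_of_nonneg_left ?_ hμpos.le
      rw [hB]; have := Real.sqrt_nonneg s; linarith
    constructor <;> linarith
  have hμs : μ * Real.sqrt s < r ∧ μ * Real.sqrt s ≤ 1 / 2 := by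
    have : μ * Real.sqrt s ≤ μ * B - μ := by
      rw [← mul_sub_one]; refine mul_le_mul_of_nonneg_left ?_ hμpos.le
      rw [hB]; linarith
    constructor <;> linarith
  have hμ2s : μ ^ 2 * s < r ^ 2 ∧ μ ^ 2 * s ≤ 1 := by
    have e : μ ^ 2 * s = (μ * Real.sqrt s) ^ 2 := by
      rw [mul_pow, Real.sq_sqrt hspos.le]
    have h0 : 0 ≤ μ * Real.sqrt s := by positivity
    rw [e]
    constructor
    · exact pow_lt_pow_left₀ hμs.1 h0 two_ne_zero
    · have h1 := mul_le_mul hμs.2 hμs.2 h0 (by norm_num)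
      rw [sq]; linarith
  -- ## the slab piece containing the zoomed data region
  set n : ℕ := max (Nat.ceil (1 / (μ ^ 2 * s))) (Nat.ceil r) with hn
  have hn1 : 1 / (μ ^ 2 * s) ≤ (n : ℝ) + 2 := by
    have : (Nat.ceil (1 / (μ ^ 2 * s)) : ℝ) ≤ n := by rw [hn]; exact_mod_cast le_max_left _ _
    have := Nat.le_ceil (1 / (μ ^ 2 * s)); linarith
  have hμ2spos : 0 < μ ^ 2 * s := by positivity
  have hpiece : ∀ y : EuclideanSpace ℝ (Fin 3), ‖y‖ ≤ A →
      ((μ ^ 2 * t₁, μ • y) : ℝ × EuclideanSpace ℝ (Fin 3)) ∈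
        Icc (-((n : ℝ) + 2)) (-(1 / ((n : ℝ) + 2))) ×ˢ
          closedBall (0 : EuclideanSpace ℝ (Fin 3)) ((n : ℝ) + 2) := by
    intro y hy
    refine ⟨⟨?_, ?_⟩, ?_⟩
    · have : μ ^ 2 * t₁ = -(μ ^ 2 * s) := by rw [hs]; ring
      rw [this]; have : (1 : ℝ) ≤ (n : ℝ) + 2 := by have := n.cast_nonneg (α := ℝ); linarith
      linarith [hμ2s.2]
    · have : μ ^ 2 * t₁ = -(μ ^ 2 * s) := by rw [hs]; ring
      rw [this, neg_le_neg_iff, div_le_iff₀ (by positivity : (0 : ℝ) < (n : ℝ) + 2)]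
      rw [div_le_iff₀ hμ2spos] at hn1
      linarith
    · rw [mem_closedBall_zero_iff, norm_smul, Real.norm_of_nonneg hμpos.le]
      have : μ * ‖y‖ ≤ μ * A := mul_le_mul_of_nonneg_left hy hμpos.le
      linarith [hμA.1]
  -- ## one member whose slice is uniformly close to `W` on the piece
  have hδ : 0 < ε₀ / (2 * μ) := by positivity
  obtain ⟨k, hk⟩ := ((Metric.tendstoUniformlyOn_iff.1 (hunif n)) (ε₀ / (2 * μ)) hδ).exists
  -- ## the zoomed member `v = (w k)_μ` and its small slice
  set v : ℝ → EuclideanSpace ℝ (Fin 3) → EuclideanSpace ℝ (Fin 3) := nsRescale μ (w k) with hv_def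
  have hv : IsTypeIAncientMild C v := isTypeIAncientMild_nsRescale (hwk k) hμpos
  have hvlaw := RecurrentReductionD.dissipationLaw_nsRescale (hlaw k) hμpos
  have hvL6 : ∀ τ : ℝ, τ < 0 → eLpNorm (v τ) 6 volume ≤ ENNReal.ofReal (k₆ * (-τ) ^ (-(1 / 4 : ℝ))) :=
    fun τ hτ => hCS C K v hv hvlaw τ hτ
  have hvdata : ∀ y : EuclideanSpace ℝ (Fin 3), ‖y‖ ≤ A → ‖v t₁ y‖ ≤ ε₀ := by
    intro y hy
    have e : v t₁ y = μ • w k (μ ^ 2 * t₁) (μ • y) := by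
      rw [hv_def, nsRescale_apply]
    rw [e, norm_smul, Real.norm_of_nonneg hμpos.le]
    have hz := hk (μ ^ 2 * t₁, μ • y) (hpiece y hy)
    dsimp only at hz
    rw [dist_eq_norm] at hz
    have hzt : μ ^ 2 * t₁ ∈ Ioo (-(r ^ 2)) (0 : ℝ) := by
      have : μ ^ 2 * t₁ = -(μ ^ 2 * s) := by rw [hs]; ring
      rw [this]; exact ⟨by linarith [hμ2s.1], by linarith⟩
    have hzx : μ • y ∈ ball (0 : EuclideanSpace ℝ (Fin 3)) r := by
      rw [mem_ball_zero_iff, norm_smul, Real.norm_of_nonneg hμpos.le]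
      have : μ * ‖y‖ ≤ μ * A := mul_le_mul_of_nonneg_left hy hμpos.le
      linarith [hμA.1]
    have hWz := hWb _ hzt _ hzx
    have h1 : ‖w k (μ ^ 2 * t₁) (μ • y)‖ ≤ Mb' + ε₀ / (2 * μ) := by
      have := norm_le_norm_sub_add (w k (μ ^ 2 * t₁) (μ • y)) (W (μ ^ 2 * t₁) (μ • y))
      rw [norm_sub_rev] at this
      linarith [hz.le]
    calc μ * ‖w k (μ ^ 2 * t₁) (μ • y)‖ ≤ μ * (Mb' + ε₀ / (2 * μ)) :=
          mul_le_mul_of_nonneg_left h1 hμpos.le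
      _ = μ * Mb' + ε₀ / 2 := by field_simp
      _ ≤ ε₀ := by linarith
  -- ## ε-regularity bounds `v` near the origin ...
  have hbound := hER v hv hvL6 hvdata
  -- ## ... contradicting the scale invariance of the singularity of `w k`
  set r' : ℝ := min 1 (Real.sqrt s) with hr'
  have hr'pos : 0 < r' := lt_min one_pos (Real.sqrt_pos.2 hspos)
  obtain ⟨t, ht, x, hx, hbig⟩ :=
    RecurrentReductionD.singularAtOrigin_nsRescale (hsing k) hμpos r' hr'pos 1
  have ht' : t ∈ Ioo t₁ 0 := by
    refine ⟨?_, ht.2⟩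
    have h1 : r' ≤ Real.sqrt s := min_le_right _ _
    have h2 : r' ^ 2 ≤ Real.sqrt s ^ 2 := pow_le_pow_left₀ hr'pos.le h1 2
    rw [Real.sq_sqrt hspos.le] at h2
    rw [show t₁ = -s by rw [hs]; ring]
    linarith [ht.1]
  have hx' : ‖x‖ < 2 := by
    rw [mem_ball_zero_iff] at hx
    linarith [min_le_left (1 : ℝ) (Real.sqrt s)]
  have := hbound t ht' x hx'
  rw [← hv_def] at hbig
  linarith

end Summit.NavierStokesRegularity.NavierStokesRegularity.Theorems.FiniteDissipationLiouville.Compactness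

end
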